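import Summits.QuantumFields.GaugeBoot.TiltedBoxTwoDimEvenSiteBlocks
import Summits.QuantumFields.GaugeBoot.TiltedBoxTwoDimMidAnnulus
import HarnessLib

/-!
# The even square tilted box in two dimensions: the reduced-half energy of the site mirror and the twists of the two annuli (gauge-boot, L3 supplement: 2D slab gluing, reduced-half site mirror 2/4)

HONEST FRAMING (cell `pub-gaugeboot`, page 1 of every file): the venture produces certified bounds
on lattice expectations at stated coupling, gauge group, dimension and torus size; NOT a mass gap,
NOT a continuum limit, NOT a string tension; NOT Yang–Mills-summit-bearing (barriers
`FixedCouplingUltralocality`, `PerturbativeInvisibility`). Bookkeeping for the POSITIVE two-dimensional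
result `TiltedBoxEvenAxisRPTwoDim.lean`; it discharges nothing else.

Continuation of `TiltedBoxTwoDimEvenSiteBlocks.lean` (even square box `ℤ^d/Γ(2P, 2P, L)`, `P ≥ 2`, two
dimensions, site mirror `Θ_i : x_i ↦ -x_i`, reduced half `{0 ≤ x_i ≤ P - 1}`):

* `redSiteWeight p ∈ {0, 1}` (`1` iff the plaquette is based in a layer `x_i ≤ P - 2`, i.e. all four links
  in the reduced half), `redSiteExpo` the half-weighted action `E`, and the cancellation identity
  **`redSiteExpo_configReflect_add`**: `E(ΘU) + E(U) - S(U) = -∑_{slab (P-1) ∪ slab P} (N - Re tr ρ(U_p))`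
  — the half and its mirror image cover every plaquette once, except the TWO annuli around the free layer;
  `plaqObs_eq_of_redSiteWeight_ne_zero` (non-zero weight ⇒ read off the shared and positive links);
* the twists of the annulus words: the letters of the free layer are shared by the two annuli
  (`loAt_layerSite_eq_upAt`), and the mirror image of the word of the layer `P - 1` is a CONJUGATE of the
  word of the layer `P + 1` (`loAt_predLayerSite_configReflect`, `oprod_upAt_layerSite_eq_conj`).

References: K. Osterwalder, E. Seiler, Ann. Phys. 110 (1978) 440, §2; A. A. Migdal, Sov. Phys. JETP 42
(1975) 413; J. Fröhlich, R. Israel, E. H. Lieb, B. Simon, J. Stat. Phys. 22 (1980) 297, §3.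
-/

noncomputable section

open QuotientAddGroup Finset Function

namespace Summit.QuantumFields.GaugeBoot

namespace TiltedRP

open IsSiteFrame (plaqReflect plaqReflect_fst_of_hasDir plaqReflect_snd)

namespace TwoDim

variable {d : ℕ} {i j : Fin d} {L P N : ℕ} [NeZero L] [NeZero P]
variable {G : Type*} [Group G]
variable (ρ : G →* Matrix (Fin N) (Fin N) ℂ)

/-! ## `ZMod (2P)`: the two rung layers -/

omit [NeZero L] [NeZero P] in
/-- `a = n ↔ a.val = n` for `n < 2P`. [folklore] -/
theorem eq_natCast_iff_val_eq_even (hP : 2 ≤ P) {a : ZMod (2 * P)} {n : ℕ} (hn : n < 2 * P) :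
    a = ((n : ℕ) : ZMod (2 * P)) ↔ a.val = n := by
  haveI := neZero_two_mul hP
  have hv : (((n : ℕ) : ZMod (2 * P))).val = n := by rw [ZMod.val_natCast, Nat.mod_eq_of_lt hn]
  constructor
  · intro h; rw [h, hv]
  · intro h; apply ZMod.val_injective; rw [h, hv]

omit [NeZero L] [NeZero P] in
/-- The two rung layers `P - 1`, `P` as classes and as values. [folklore] -/
theorem rungLayerE_iff (hP : 2 ≤ P) (a : ZMod (2 * P)) :
    (a = ((P : ℕ) : ZMod (2 * P)) - 1 ∨ a = ((P : ℕ) : ZMod (2 * P))) ↔ (a.val = P - 1 ∨ a.val = P) := by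
  have h1 : ((P : ℕ) : ZMod (2 * P)) - 1 = ((P - 1 : ℕ) : ZMod (2 * P)) := by
    rw [Nat.cast_sub (by omega), Nat.cast_one]
  rw [h1, eq_natCast_iff_val_eq_even hP (by omega), eq_natCast_iff_val_eq_even hP (by omega)]

/-! ## The reduced-half weights and the energy -/

/-- **The reduced-half weight of a plaquette** of the even box (site mirror): `1` if it is based in a
layer `x_i ≤ P - 2` (in two dimensions: iff all four links lie in `{0 ≤ x_i ≤ P - 1}`), `0` otherwise. -/
def redSiteWeight (p : Plaq (TiltedSite d i j (2 * P) (2 * P) L) d) : ℝ :=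
  if (axisCoord d L (2 * P) p.1).val + 2 ≤ P then 1 else 0

/-- The half-weighted action `E(U) = ∑_p c_p (N - Re tr ρ(U_p))` of the reduced half. -/
def redSiteExpo (U : Config (TiltedSite d i j (2 * P) (2 * P) L) d G) : ℝ :=
  ∑ p : Plaq (TiltedSite d i j (2 * P) (2 * P) L) d,
    redSiteWeight p * ((N : ℝ) - plaqObs ρ (tiltedUnit d i j (2 * P) (2 * P) L) p U)

/-- `E` is continuous. [folklore] -/
theorem continuous_redSiteExpo [TopologicalSpace G] [IsTopologicalGroup G] (hρ : Continuous ρ) :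
    Continuous fun U : Config (TiltedSite d i j (2 * P) (2 * P) L) d G => redSiteExpo ρ U :=
  continuous_finsetSum _ fun p _ => continuous_const.mul (continuous_const.sub (continuous_plaqObs ρ hρ _ p))

omit [NeZero L] [NeZero P] in
/-- **The cancellation identity** (two dimensions): `c_p + c_{Θp} = 0` for the plaquettes of the two annuli
(based in the layers `P - 1`, `P`), `= 1` for all others. [folklore] -/
theorem redSiteWeight_add_redSiteWeight_plaqReflect (hP : 2 ≤ P) (hij : i ≠ j) (hd : ∀ k : Fin d, k = i ∨ k = j)
    (p : Plaq (TiltedSite d i j (2 * P) (2 * P) L) d) :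
    redSiteWeight p + redSiteWeight (plaqReflect (tiltedUnit d i j (2 * P) (2 * P) L) i (tiltedAxisFlip d L (2 * P) hij) p) =
      if (axisCoord d L (2 * P) p.1).val = P - 1 ∨ (axisCoord d L (2 * P) p.1).val = P then 0 else 1 := by
  have hp : HasDir p i := hasDir_left hij hd p
  have hc := val_lt_two_mul hP (axisCoord d L (2 * P) p.1)
  unfold redSiteWeight
  rw [plaqReflect_fst_of_hasDir hp, map_sub, axisCoord_tiltedAxisFlip, axisCoord_tiltedUnit_self, val_neg_sub_one hP]
  split_ifs <;> first | (norm_num; done) | (exfalso; omega)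

/-- **`E(ΘU) + E(U) - S(U) = -∑_{slab (P-1) ∪ slab P} (N - Re tr ρ(U_p))`** (two dimensions): the reduced
half and its mirror image cover every plaquette once, except the two annuli around the free layer. [folklore] -/
theorem redSiteExpo_configReflect_add [TopologicalSpace G] [IsTopologicalGroup G] [CompactSpace G]
    (hP : 2 ≤ P) (hij : i ≠ j) (hd : ∀ k : Fin d, k = i ∨ k = j) (hρ : Continuous ρ)
    (U : Config (TiltedSite d i j (2 * P) (2 * P) L) d G) :
    redSiteExpo ρ (configReflect (tiltedUnit d i j (2 * P) (2 * P) L) i (tiltedAxisFlip d L (2 * P) hij) U) +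
      redSiteExpo ρ U - wilsonAction ρ (tiltedUnit d i j (2 * P) (2 * P) L) U =
      -∑ p ∈ Finset.univ.filter (fun p => SquareSlab.IsSlabPlaq (((P : ℕ) : ZMod (2 * P)) - 1) p ∨
          SquareSlab.IsSlabPlaq ((P : ℕ) : ZMod (2 * P)) p),
        ((N : ℝ) - plaqObs ρ (tiltedUnit d i j (2 * P) (2 * P) L) p U) := by
  have hF : IsAxisFlip (tiltedUnit d i j (2 * P) (2 * P) L) i (tiltedAxisFlip d L (2 * P) hij) :=
    isAxisFlip_tiltedAxisFlip d L (2 * P) hij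
  have h1 : redSiteExpo ρ (configReflect (tiltedUnit d i j (2 * P) (2 * P) L) i (tiltedAxisFlip d L (2 * P) hij) U) =
      ∑ p : Plaq (TiltedSite d i j (2 * P) (2 * P) L) d,
        redSiteWeight (plaqReflect (tiltedUnit d i j (2 * P) (2 * P) L) i (tiltedAxisFlip d L (2 * P) hij) p) *
          ((N : ℝ) - plaqObs ρ (tiltedUnit d i j (2 * P) (2 * P) L) p U) := by
    unfold redSiteExpo
    simp_rw [hF.plaqObs_configReflect ρ hρ]
    exact Fintype.sum_equiv (Function.Involutive.toPerm _ hF.plaqReflect_plaqReflect) _ _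
      fun p => by simp [hF.plaqReflect_plaqReflect p]
  rw [h1, redSiteExpo, wilsonAction, ← Finset.sum_add_distrib, ← Finset.sum_sub_distrib, ← Finset.sum_neg_distrib,
    Finset.sum_filter]
  refine Finset.sum_congr rfl fun p _ => ?_
  have h2 := redSiteWeight_add_redSiteWeight_plaqReflect hP hij hd p
  rw [add_comm] at h2
  have hp : HasDir p i := hasDir_left hij hd p
  have hiff : (SquareSlab.IsSlabPlaq (((P : ℕ) : ZMod (2 * P)) - 1) p ∨ SquareSlab.IsSlabPlaq ((P : ℕ) : ZMod (2 * P)) p) ↔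
      ((axisCoord d L (2 * P) p.1).val = P - 1 ∨ (axisCoord d L (2 * P) p.1).val = P) := by
    unfold SquareSlab.IsSlabPlaq
    rw [← rungLayerE_iff hP]
    have hp' : p.2.1.1 = i ∨ p.2.1.2 = i := hp
    simp only [hp', true_and]
  by_cases hs : SquareSlab.IsSlabPlaq (((P : ℕ) : ZMod (2 * P)) - 1) p ∨ SquareSlab.IsSlabPlaq ((P : ℕ) : ZMod (2 * P)) p
  · rw [if_pos (hiff.1 hs)] at h2; rw [if_pos hs]
    linear_combination ((N : ℝ) - plaqObs ρ (tiltedUnit d i j (2 * P) (2 * P) L) p U) * h2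
  · rw [if_neg (fun h => hs (hiff.2 h))] at h2; rw [if_neg hs]
    linear_combination ((N : ℝ) - plaqObs ρ (tiltedUnit d i j (2 * P) (2 * P) L) p U) * h2

/-! ## Plaquettes of non-zero weight are read off the blocks -/

/-- A link based in a layer `x_i ≤ P - 2`, in direction `i` or `j`, is positive or shared. [folklore] -/
theorem mem_blocksE_of_base {x : TiltedSite d i j (2 * P) (2 * P) L}
    (hx : (axisCoord d L (2 * P) x).val + 2 ≤ P) {m : Fin d} (hm : m = i ∨ m = j) :
    (x, m) ∈ posBlockE d i j L P ∨ (x, m) ∈ shBlockE d i j L P := by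
  have h0 : axisCoord d L (2 * P) x = 0 ↔ (axisCoord d L (2 * P) x).val = 0 := eq_zero_iff_val _
  rcases hm with rfl | rfl
  · exact Or.inl (mem_posBlockE.2 (Or.inr ⟨rfl, hx⟩))
  · by_cases hz : (axisCoord d L (2 * P) x).val = 0
    · exact Or.inr (mem_shBlockE.2 ⟨rfl, h0.2 hz⟩)
    · exact Or.inl (mem_posBlockE.2 (Or.inl ⟨rfl, Nat.one_le_iff_ne_zero.2 hz,
        (by omega : (axisCoord d L (2 * P) x).val + 1 ≤ P)⟩))

/-- The far links of a plaquette based in a layer `x_i ≤ P - 2` are positive. [folklore] -/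
theorem mem_blocksE_step (hP : 2 ≤ P) (hij : i ≠ j) {x : TiltedSite d i j (2 * P) (2 * P) L}
    (hx : (axisCoord d L (2 * P) x).val + 2 ≤ P) {a b : Fin d}
    (ha : a = i ∨ a = j) (hb : b = i ∨ b = j) (hab : a ≠ b) :
    (x + tiltedUnit d i j (2 * P) (2 * P) L a, b) ∈ posBlockE d i j L P ∨
      (x + tiltedUnit d i j (2 * P) (2 * P) L a, b) ∈ shBlockE d i j L P := by
  left
  rw [mem_posBlockE]
  simp only
  rw [axisCoord_add_tiltedUnit]
  rcases ha with rfl | rfl <;> rcases hb with rfl | rfl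
  · exact (hab rfl).elim
  · rw [if_pos rfl, val_add_one hP, if_neg (by omega)]
    exact Or.inl ⟨rfl, by omega, by omega⟩
  · rw [if_neg (Ne.symm hij), add_zero]
    exact Or.inr ⟨rfl, hx⟩
  · exact (hab rfl).elim

/-- **A plaquette of non-zero weight is read off the shared and positive links** (two dimensions). [folklore] -/
theorem plaqObs_eq_of_redSiteWeight_ne_zero (hP : 2 ≤ P) (hij : i ≠ j) (hd : ∀ k : Fin d, k = i ∨ k = j)
    {U V : Config (TiltedSite d i j (2 * P) (2 * P) L) d G}
    (hUV : ∀ l, (l ∈ posBlockE d i j L P ∨ l ∈ shBlockE d i j L P) → U l = V l)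
    {p : Plaq (TiltedSite d i j (2 * P) (2 * P) L) d} (hp : redSiteWeight p ≠ 0) :
    plaqObs ρ (tiltedUnit d i j (2 * P) (2 * P) L) p U = plaqObs ρ (tiltedUnit d i j (2 * P) (2 * P) L) p V := by
  have hx : (axisCoord d L (2 * P) p.1).val + 2 ≤ P := by
    unfold redSiteWeight at hp
    by_contra h
    exact hp (if_neg h)
  have hne : p.2.1.1 ≠ p.2.1.2 := ne_of_lt p.2.2
  unfold plaqObs
  rw [holonomy_congr _ p.1 p.2.1.1 p.2.1.2 (hUV _ (mem_blocksE_of_base hx (hd _)))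
    (hUV _ (mem_blocksE_step hP hij hx (hd _) (hd _) hne)) (hUV _ (mem_blocksE_step hP hij hx (hd _) (hd _) hne.symm))
    (hUV _ (mem_blocksE_of_base hx (hd _)))]

/-- `E` depends only on the shared and positive links (two dimensions). [folklore] -/
theorem redSiteExpo_eq_of_blocks (hP : 2 ≤ P) (hij : i ≠ j) (hd : ∀ k : Fin d, k = i ∨ k = j)
    {U V : Config (TiltedSite d i j (2 * P) (2 * P) L) d G}
    (hUV : ∀ l, (l ∈ posBlockE d i j L P ∨ l ∈ shBlockE d i j L P) → U l = V l) :
    redSiteExpo ρ U = redSiteExpo ρ V := by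
  unfold redSiteExpo
  refine Finset.sum_congr rfl fun p _ => ?_
  by_cases hp : redSiteWeight p = 0
  · rw [hp, zero_mul, zero_mul]
  · rw [plaqObs_eq_of_redSiteWeight_ne_zero ρ hP hij hd hUV hp]

/-! ## The twists of the two annulus words -/

omit [NeZero L] [NeZero P] in
/-- The cycle through `y + e_i` is the cycle through `y`, shifted by `e_i` (square box of any side). [folklore] -/
theorem cyc_add_unit {M : ℕ} (y : TiltedSite d i j M M L) (t : ℕ) :
    cyc (y + tiltedUnit d i j M M L i) t = cyc y t + tiltedUnit d i j M M L i := by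
  unfold cyc
  abel

omit [NeZero L] [NeZero P] in
/-- The cycle through `y₀` is the cycle through `y₋ = y₀ - e_i`, shifted by `e_i`. [folklore] -/
theorem cyc_layerSite_eq (t : ℕ) :
    cyc (layerSite d L P : TiltedSite d i j (2 * P) (2 * P) L) t =
      cyc (predLayerSite d L P : TiltedSite d i j (2 * P) (2 * P) L) t + tiltedUnit d i j (2 * P) (2 * P) L i := by
  unfold cyc predLayerSite
  abel

omit [NeZero L] [NeZero P] [Group G] in
/-- **The letters of the free layer are shared**: the lower letters of the annulus through `y₀` are the
upper letters of the annulus through `y₋`. [folklore] -/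
theorem loAt_layerSite_eq_upAt (t : ℕ) (U : Config (TiltedSite d i j (2 * P) (2 * P) L) d G) :
    loAt (layerSite d L P : TiltedSite d i j (2 * P) (2 * P) L) t U =
      upAt (predLayerSite d L P : TiltedSite d i j (2 * P) (2 * P) L) t U := by
  unfold loAt upAt
  rw [cyc_layerSite_eq]

omit [NeZero L] [NeZero P] in
/-- **The word of the layer `P - 1` is twisted by the mirror**: `a_t(Θ_i U) = c_{t+2P}(U)` where `a_t` are
the letters of the layer `P - 1` (through `y₋`) and `c_t` the letters of the layer `P + 1` (upper letters
through `y₀`). [folklore] -/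
theorem loAt_predLayerSite_configReflect (hij : i ≠ j) (t : ℕ) (U : Config (TiltedSite d i j (2 * P) (2 * P) L) d G) :
    loAt (predLayerSite d L P : TiltedSite d i j (2 * P) (2 * P) L) t
        (configReflect (tiltedUnit d i j (2 * P) (2 * P) L) i (tiltedAxisFlip d L (2 * P) hij) U) =
      upAt (layerSite d L P : TiltedSite d i j (2 * P) (2 * P) L) (t + 2 * P) U := by
  unfold loAt upAt
  rw [configReflect_other _ i _ U _ (Ne.symm hij), tiltedAxisFlip_cyc_pred hij, cyc_add_unit]

omit [NeZero L] [NeZero P] in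
/-- **The twist is a conjugation of the word of the layer `P + 1`**:
`∏_{t<4P} c_t(U) = c · (∏_{t<4P} a_t(Θ_i U)) · c⁻¹`, `c = c_0 ⋯ c_{2P-1}`. [folklore] -/
theorem oprod_upAt_layerSite_eq_conj (hij : i ≠ j) (U : Config (TiltedSite d i j (2 * P) (2 * P) L) d G) :
    SlabKernel.oprod (upAt (layerSite d L P : TiltedSite d i j (2 * P) (2 * P) L)) (2 * (2 * P)) U =
      SlabKernel.oprod (upAt (layerSite d L P : TiltedSite d i j (2 * P) (2 * P) L)) (2 * P) U *
        SlabKernel.oprod (loAt (predLayerSite d L P : TiltedSite d i j (2 * P) (2 * P) L)) (2 * (2 * P))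
          (configReflect (tiltedUnit d i j (2 * P) (2 * P) L) i (tiltedAxisFlip d L (2 * P) hij) U) *
        (SlabKernel.oprod (upAt (layerSite d L P : TiltedSite d i j (2 * P) (2 * P) L)) (2 * P) U)⁻¹ := by
  have hΘ : SlabKernel.oprod (loAt (predLayerSite d L P : TiltedSite d i j (2 * P) (2 * P) L)) (2 * (2 * P))
      (configReflect (tiltedUnit d i j (2 * P) (2 * P) L) i (tiltedAxisFlip d L (2 * P) hij) U) =
      SlabKernel.oprod (fun t => upAt (layerSite d L P : TiltedSite d i j (2 * P) (2 * P) L) ((2 * P) + t))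
        (2 * (2 * P)) U := by
    unfold SlabKernel.oprod
    congr 1
    refine List.map_congr_left fun t _ => ?_
    rw [loAt_predLayerSite_configReflect hij, add_comm t (2 * P)]
  rw [hΘ, show 2 * (2 * P) = (2 * P) + (2 * P) from two_mul _,
    SlabKernel.oprod_add (upAt (layerSite d L P : TiltedSite d i j (2 * P) (2 * P) L)) (2 * P) (2 * P) U,
    SlabKernel.oprod_add (fun t => upAt (layerSite d L P : TiltedSite d i j (2 * P) (2 * P) L) ((2 * P) + t))
      (2 * P) (2 * P) U]
  have hper : SlabKernel.oprod (fun t => upAt (layerSite d L P : TiltedSite d i j (2 * P) (2 * P) L)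
      ((2 * P) + ((2 * P) + t))) (2 * P) U =
      SlabKernel.oprod (upAt (layerSite d L P : TiltedSite d i j (2 * P) (2 * P) L)) (2 * P) U := by
    unfold SlabKernel.oprod
    congr 1
    refine List.map_congr_left fun t _ => ?_
    show upAt (layerSite d L P) ((2 * P) + ((2 * P) + t)) U = upAt (layerSite d L P) t U
    rw [show (2 * P) + ((2 * P) + t) = t + 2 * (2 * P) by ring, upAt_add_two_mul hij]
  rw [hper]
  group

end TwoDim

end TiltedRP

end Summit.QuantumFields.GaugeBoot

end
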